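import Summits.CriticalPhenomena.PercolationContinuityZ3.Theorems.Transplant.SkelPhiStepINegOrient
import Summits.CriticalPhenomena.PercolationContinuityZ3.Theorems.Transplant.SkelFrmBParamsLF
import Summits.CriticalPhenomena.PercolationContinuityZ3.Theorems.Transplant.SkelNegBParamsLF
import Summits.CriticalPhenomena.PercolationContinuityZ3.Theorems.Transplant.SkelFrm1ParamsLO
import Summits.CriticalPhenomena.PercolationContinuityZ3.Theorems.Transplant.SkelNeg1ParamsLO
import Summits.CriticalPhenomena.PercolationContinuityZ3.Theorems.Transplant.SkelPhiCellsWeakGLevels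
import Summits.CriticalPhenomena.PercolationContinuityZ3.Theorems.Transplant.SkelNegBParamsLO
import Summits.CriticalPhenomena.PercolationContinuityZ3.Theorems.Transplant.PlanarSkeletonFrmDefs
import Summits.CriticalPhenomena.PercolationContinuityZ3.Theorems.Transplant.SkelPhiStepIDataNS
import HarnessLib

/-!
# N2 (frames-only node `SamePDropOfSkeletonFrm₁`, OPEN) params column over `PlanarSkeletonFrm` — (ζ″) ledger, shape (B′) of record ((R-14)):
# MECHANICAL PORT of N1's `SkelNegBParamsLO` — chain of record `NegB` (box slot `g`), part LO (re-version of `SkelNeg1ParamsLO` p283062 with one more argument `g`;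
# `oS/φS/clauseS` are `Neg`'s, unchanged): the params column AT THE MERGED RECORD `D.orient DT ori` — the two orientation bits `Neg.oS/oL`, the two oriented maps
# `Neg.φS/φL` (kit … (N1 title abridged; see `SkelNegBParamsLO`)
builds on p205010 (kernel theorem, internal audit signed; external expert review pending) — nothing in this file uses p205010; NOTHING is claimed about the
open node `SamePDropOfSkeletonFrm₁` (`SamePDropOfSkeletonNeg₁` is CLOSED in the tree and untouched by this file).
Status sentence (coordinator 2026-08-20T04:30Z): "θ(p_c) = 0 on ℤ^d, all d ≥ 2 — kernel-verified (Lean 4/Mathlib, standard axioms); internal adversarial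
audit SIGNED 2026-08-20 04:29Z; external expert review pending."
Lane `prim-bschramm-*`, seat `prim-bschramm-stmt` (gen 19); helper file (`--supports stmt-CriticalPhenomena-4575 --as helper`); ledger HOME/prim-bschramm-stmt/FRM-PARAMS.md §9, (R-14).
PORT RULES (HOME/prim-bschramm-stmt-g19/lean/port_frm.py, the tool of record per (R-14)): outer namespace `PlanarSkeletonNeg ↦ PlanarSkeletonFrm`, carrier binder
`(Φ : PlanarSkeletonFrm G)`, record binder `(D : Skelφ.StepI.DataNS V)` (the selectors travel IN the record, `SkelPhiStepIDataNS`); section variables INLINED into every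
declaration header; inner namespaces (`Neg`/`NegB`/`KS`/…) and every short name KEPT so all cross-references resolve unchanged; declarations using no section variable are
NOT re-declared (N1's originals are referenced fully qualified). Mathematical content, proofs, docstrings and citations are N1's, verbatim, except where stated next.
SELECTORS IN THIS FILE ((R-14) condition of record — joint selection, `D.sN`'s first argument is the literal handed to `D.sM`): none (pure port; the pairs are read through their N1 names).
N1 HEADER (kept for the reader):
helper file (`--supports stmt-CriticalPhenomena-4575 --as helper`); ledger HOME/prim-bschramm-stmt/NEG-PARAMS.md v0.8;
lead g6 2026-08-21T14:23:27Z (2): the params-side IMPLEMENTATION of p3-g8's `ChoiceNO` (one interface), values only.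
HOW TO READ IT: p3-g8's Step I″-O hands `O = (D, DT, ori)` with `FactsO` (shared `Λ/k/R/M₀/n₁`; at each admissible `(M, n)` the geometric clause + `|h| ≤ 10n` for `(Φ.φ, D)` if
`ori t M n`, for `(trφ Φ.φ, DT)` otherwise).  The ledger evaluates EVERY value at the merged record `Dᵒ := D.orient DT ori` (so `Mu/nS/hS/…/ML/nL f/hL/…/fcells/Sz/SMn` are the
values of the chosen orientations, files Scales…LF unchanged), reads the two bits `oS := ori t M_u n_s`, `oL := ori t M_L (n_L f)`, and sites the kit routes with `φS := oriφ Φ.φ oS`,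
the cells with `φL := oriφ Φ.φ oL`; the window map of record is `fineO := Neg.fine κ Φ t p Dᵒ f φL`.
* §1 `oS/oL/φS/φL/fineO`, `lip_φS/φL`, `steps_φS/φL`;
* §2 **`clauseL_of_factsO`** (`Dᵒ.EqGeom G φL t M_L (n_L f) ∧ |h_L| ≤ 10·n_L`), **`eqNumL_of_factsO`**, **`clauseS_of_factsO`** (short pair, for the kit port), `kappa_L/S` (the κ ≤ 10 slot `hκ`);
* §3 **`geom_fine_at`** (map slot `φ′`: the nine `GeomHoldsN` conjuncts for `cellGeomSG₂ G (fine … φ′) fcells t Λ` from `Lip/Steps φ′`, `EqNumL`, `WFS2 fcells Λ`,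
  `∀ a x, Nrep (cen x) + 1 ≤ Λ.rQ a x`), **`geom_fineO_of_factsO`** (the same at `fineO` from `FactsO`'s clauses).
[cite: KozmaNitzan2024, §4 Theorem 6 (pp. 25–31), pp. 25–27 (Q_v, M_v, E_{v,x}, H^j_{v,x})] [cite: MartineauTassion2017, §3.2 Lemma 3.5, §4.3]
-/

noncomputable section

open scoped Classical

namespace Summit.CriticalPhenomena.PercolationContinuityZ3.Theorems.Transplant

namespace PlanarSkeletonFrm

namespace NegB

open Literature.Probability.Percolation Literature.Probability.LatticeModels SimpleGraph KNCells
open SkelConc (Consts)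
open BoxProdZ2 (ConcRadiiG)
open Skelφ (oriφ trφ)
open Skelφ.StepI (DataN)
open Neg

section LOLevel

/-! ## §1 The orientation bits and the oriented maps at the two pairs -/

/-- **The long pair's orientation bit** `oL := ori t M_L (n_L f)` (values at the merged record). [this work] -/
def oL (κ : Consts) {V : Type} [DecidableEq V] [Countable V] {G : SimpleGraph V} [G.LocallyFinite] (Φ : PlanarSkeletonFrm G) (t : V) (p : unitInterval) (D : Skelφ.StepI.DataNS V) (DT : DataN V) (ori : V → ℕ → ℕ → Bool) (g : ℕ) (f : ℕ) : Bool := ori t (ML κ Φ t p (D.orient DT ori) g) (nL κ Φ t p (D.orient DT ori) g f)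

/-- **The planar map the CELLS read** (long pair): `Φ.φ` or its transpose. [this work] -/
def φL (κ : Consts) {V : Type} [DecidableEq V] [Countable V] {G : SimpleGraph V} [G.LocallyFinite] (Φ : PlanarSkeletonFrm G) (t : V) (p : unitInterval) (D : Skelφ.StepI.DataNS V) (DT : DataN V) (ori : V → ℕ → ℕ → Bool) (g : ℕ) (f : ℕ) : V → Site 2 := oriφ Φ.φ (oL κ Φ t p D DT ori g f)

/-- **THE FINE WINDOW MAP OF RECORD, ORIENTED**: `fineO := Neg.fine κ Φ t p (orient D DT ori) f φL`. [this work] -/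
def fineO (κ : Consts) {V : Type} [DecidableEq V] [Countable V] {G : SimpleGraph V} [G.LocallyFinite] (Φ : PlanarSkeletonFrm G) (t : V) (p : unitInterval) (D : Skelφ.StepI.DataNS V) (DT : DataN V) (ori : V → ℕ → ℕ → Bool) (g : ℕ) (f : ℕ) : V → Site 2 := fine κ Φ t p (D.orient DT ori) g f (φL κ Φ t p D DT ori g f)

/-- `φL` is 1-Lipschitz. [folklore] -/
theorem lip_φL (κ : Consts) {V : Type} [DecidableEq V] [Countable V] {G : SimpleGraph V} [G.LocallyFinite] (Φ : PlanarSkeletonFrm G) (t : V) (p : unitInterval) (D : Skelφ.StepI.DataNS V) (DT : DataN V) (ori : V → ℕ → ℕ → Bool) (g : ℕ) (f : ℕ) : Skelφ.Lip G (φL κ Φ t p D DT ori g f) := Skelφ.lip_oriφ Φ.lip _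

/-- `φL` has unit steps. [folklore] -/
theorem steps_φL (κ : Consts) {V : Type} [DecidableEq V] [Countable V] {G : SimpleGraph V} [G.LocallyFinite] (Φ : PlanarSkeletonFrm G) (t : V) (p : unitInterval) (D : Skelφ.StepI.DataNS V) (DT : DataN V) (ori : V → ℕ → ℕ → Bool) (g : ℕ) (f : ℕ) : Skelφ.Steps G (φL κ Φ t p D DT ori g f) := Skelφ.steps_oriφ Φ.step _

/-- `fineO` unfolded. [folklore] -/
theorem fineO_eq (κ : Consts) {V : Type} [DecidableEq V] [Countable V] {G : SimpleGraph V} [G.LocallyFinite] (Φ : PlanarSkeletonFrm G) (t : V) (p : unitInterval) (D : Skelφ.StepI.DataNS V) (DT : DataN V) (ori : V → ℕ → ℕ → Bool) (g : ℕ) (f : ℕ) : fineO κ Φ t p D DT ori g f = fine κ Φ t p (D.orient DT ori) g f (φL κ Φ t p D DT ori g f) := rfl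

/-! ## §2 The clauses of the two pairs from `FactsO` -/

/-- The two pairs are admissible for the merged record: `M₀ ≤ M_u`, `n₁ M_u ≤ n_s`, `M₀ ≤ M_L`, `n₁ M_L ≤ n_L f`. [folklore] -/
theorem pairs_adm (κ : Consts) {V : Type} [DecidableEq V] [Countable V] {G : SimpleGraph V} [G.LocallyFinite] (Φ : PlanarSkeletonFrm G) (t : V) (p : unitInterval) (D : Skelφ.StepI.DataNS V) (DT : DataN V) (ori : V → ℕ → ℕ → Bool) (g : ℕ) (f : ℕ) : (D.orient DT ori).M₀ ≤ Mu (D.orient DT ori) ∧ (D.orient DT ori).n₁ (Mu (D.orient DT ori)) ≤ nS (D.orient DT ori) ∧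
    (D.orient DT ori).M₀ ≤ ML κ Φ t p (D.orient DT ori) g ∧ (D.orient DT ori).n₁ (ML κ Φ t p (D.orient DT ori) g) ≤ nL κ Φ t p (D.orient DT ori) g f :=
  ⟨M₀_le_Mu _, n₁_le_nS _, (M₀_le_Mu _).trans (Mu_le_ML κ Φ t p _ g), (n₁L_le_nL κ Φ t p _ g f).1⟩

/-- **THE LONG CLAUSE FROM `FactsO`**: the merged record's geometric clause at the long pair FOR THE ORIENTED MAP `φL`, and the shear bound `|h_L| ≤ 10·n_L`.
[this work] -/
theorem clauseL_of_factsO (κ : Consts) {V : Type} [DecidableEq V] [Countable V] {G : SimpleGraph V} [G.LocallyFinite] (Φ : PlanarSkeletonFrm G) (t : V) (p : unitInterval) (D : Skelφ.StepI.DataNS V) (DT : DataN V) (ori : V → ℕ → ℕ → Bool) (g : ℕ) (f : ℕ) (hR : DT.R = D.R)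
    (hfacts : ∀ M, D.M₀ ≤ M → ∀ n, D.n₁ M ≤ n →
      (ori t M n = true → D.EqGeom G Φ.φ t M n ∧ (D.hgt t M n).natAbs ≤ 10 * n) ∧
      (ori t M n = false → DT.EqGeom G (trφ Φ.φ) t M n ∧ (DT.hgt t M n).natAbs ≤ 10 * n)) :
    (D.orient DT ori).EqGeom G (φL κ Φ t p D DT ori g f) t (ML κ Φ t p (D.orient DT ori) g) (nL κ Φ t p (D.orient DT ori) g f) ∧
      (hL κ Φ t p (D.orient DT ori) g f).natAbs ≤ 10 * nL κ Φ t p (D.orient DT ori) g f := by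
  obtain ⟨-, -, hM, hn⟩ := pairs_adm κ Φ t p D DT ori g f
  exact Skelφ.StepI.orient_clause_all hR hfacts _ hM _ hn

/-- **THE NUMERIC LONG CLAUSE FROM `FactsO`** (what every LF fact consumes). [this work] -/
theorem eqNumL_of_factsO (κ : Consts) {V : Type} [DecidableEq V] [Countable V] {G : SimpleGraph V} [G.LocallyFinite] (Φ : PlanarSkeletonFrm G) (t : V) (p : unitInterval) (D : Skelφ.StepI.DataNS V) (DT : DataN V) (ori : V → ℕ → ℕ → Bool) (g : ℕ) (f : ℕ) (hR : DT.R = D.R)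
    (hfacts : ∀ M, D.M₀ ≤ M → ∀ n, D.n₁ M ≤ n →
      (ori t M n = true → D.EqGeom G Φ.φ t M n ∧ (D.hgt t M n).natAbs ≤ 10 * n) ∧
      (ori t M n = false → DT.EqGeom G (trφ Φ.φ) t M n ∧ (DT.hgt t M n).natAbs ≤ 10 * n)) :
    EqNumL κ Φ t p (D.orient DT ori) g f :=
  eqNumL_of_eqGeom κ Φ t p _ g f _ (clauseL_of_factsO κ Φ t p D DT ori g f hR hfacts).1

/-! ## §3 The scheme-geometry package of the fine cells -/

/-- **THE NINE `GeomHoldsN` CONJUNCTS FOR THE FINE CELLS, map slot `φ′`**: with `Γ := cellGeomSG₂ G (fine … φ′) fcells t Λ`, `FD := faceDataSG …`, `LD := levelDataS …`: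
`Γ.root = t`, `κ.K₀ ≤ Γ.K`, `Lip`, `RunGeom`, `AnchGeom`, `SepGeom₂`, `ExitGeom`, `StepsGeom`, `LevelGeom` — from `Lip G φ′`, `Steps G φ′`, the numeric long clause, `WFS2 fcells Λ`
and the column floor `Nrep (cen x) + 1 ≤ Λ.rQ a x` (hp-8 g33's records over a non-step map + this column's `hψ0/hlip/hws/hcol`). [cite: KozmaNitzan2024, §4 pp. 25–29] -/
theorem geom_fine_at (κ : Consts) {V : Type} [DecidableEq V] [Countable V] {G : SimpleGraph V} [G.LocallyFinite] (Φ : PlanarSkeletonFrm G) (t : V) (p : unitInterval) (D : Skelφ.StepI.DataNS V) (g : ℕ) (f : ℕ) {φ' : V → Site 2} (hlip : Skelφ.Lip G φ') (hstep : Skelφ.Steps G φ') (hN : EqNumL κ Φ t p D g f) {Λ : ConcRadiiG}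
    (hΛ : Skelφ.WFS2 (fcells κ Φ t p D g f) Λ) (hcolQ : ∀ a x, Nrep κ Φ t p D g f ((fcells κ Φ t p D g f).cen x) + 1 ≤ Λ.rQ a x) :
    (Skelφ.cellGeomSG₂ G (fine κ Φ t p D g f φ') (fcells κ Φ t p D g f) t Λ).root = t ∧
      κ.K₀ ≤ (Skelφ.cellGeomSG₂ G (fine κ Φ t p D g f φ') (fcells κ Φ t p D g f) t Λ).K ∧
      Skelφ.Lip G (fine κ Φ t p D g f φ') ∧
      RunGeom G (Skelφ.cellGeomSG₂ G (fine κ Φ t p D g f φ') (fcells κ Φ t p D g f) t Λ) ∧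
      AnchGeom (Skelφ.cellGeomSG₂ G (fine κ Φ t p D g f φ') (fcells κ Φ t p D g f) t Λ) ∧
      SepGeom₂ G (Skelφ.cellGeomSG₂ G (fine κ Φ t p D g f φ') (fcells κ Φ t p D g f) t Λ) ∧
      ExitGeom G (Skelφ.cellGeomSG₂ G (fine κ Φ t p D g f φ') (fcells κ Φ t p D g f) t Λ) ∧
      StepsGeom (Skelφ.cellGeomSG₂ G (fine κ Φ t p D g f φ') (fcells κ Φ t p D g f) t Λ)
        (Skelφ.faceDataSG G (fine κ Φ t p D g f φ') (fcells κ Φ t p D g f) t Λ) ∧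
      LevelGeom G (Skelφ.cellGeomSG₂ G (fine κ Φ t p D g f φ') (fcells κ Φ t p D g f) t Λ)
        (Skelφ.faceDataSG G (fine κ Φ t p D g f φ') (fcells κ Φ t p D g f) t Λ) (Skelφ.levelDataS (fine κ Φ t p D g f φ') (fcells κ Φ t p D g f)) := by
  have hψ0 := fine_base_at κ Φ t p D g f φ' hN
  have hlipψ := lip_fine_at κ Φ t p D g f hlip hN
  have hws := weakSteps_fine_at κ Φ t p D g f hstep hN
  have hcol := hcol_fine_of_sched κ Φ t p D g f hlip hstep hN hcolQ
  refine ⟨rfl, (fcells_K κ Φ t p D g f).2.1, hlipψ, Skelφ.runGeomSG₂ _ _, Skelφ.anchGeomSG₂ _ _, Skelφ.sepGeom₂SG₂ _ _ hΛ hψ0 hlipψ hws hcol,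
    Skelφ.exitGeomSG₂ _ _ hΛ hlipψ, Skelφ.stepsGeomSG₂ _ _ hΛ hlipψ hws, Skelφ.levelGeomSG₂ _ _ hΛ hlipψ⟩

/-- **THE NINE `GeomHoldsNO` CONJUNCTS FOR THE FINE CELLS OF RECORD, ORIENTED** — from `FactsO`'s shared radius and clauses, for every schedule with `WFS2` and the column floor.
[cite: KozmaNitzan2024, §4 pp. 25–29] -/
theorem geom_fineO_of_factsO (κ : Consts) {V : Type} [DecidableEq V] [Countable V] {G : SimpleGraph V} [G.LocallyFinite] (Φ : PlanarSkeletonFrm G) (t : V) (p : unitInterval) (D : Skelφ.StepI.DataNS V) (DT : DataN V) (ori : V → ℕ → ℕ → Bool) (g : ℕ) (f : ℕ) (hR : DT.R = D.R)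
    (hfacts : ∀ M, D.M₀ ≤ M → ∀ n, D.n₁ M ≤ n →
      (ori t M n = true → D.EqGeom G Φ.φ t M n ∧ (D.hgt t M n).natAbs ≤ 10 * n) ∧
      (ori t M n = false → DT.EqGeom G (trφ Φ.φ) t M n ∧ (DT.hgt t M n).natAbs ≤ 10 * n))
    {Λ : ConcRadiiG} (hΛ : Skelφ.WFS2 (fcells κ Φ t p (D.orient DT ori) g f) Λ)
    (hcolQ : ∀ a x, Nrep κ Φ t p (D.orient DT ori) g f ((fcells κ Φ t p (D.orient DT ori) g f).cen x) + 1 ≤ Λ.rQ a x) :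
    (Skelφ.cellGeomSG₂ G (fineO κ Φ t p D DT ori g f) (fcells κ Φ t p (D.orient DT ori) g f) t Λ).root = t ∧
      κ.K₀ ≤ (Skelφ.cellGeomSG₂ G (fineO κ Φ t p D DT ori g f) (fcells κ Φ t p (D.orient DT ori) g f) t Λ).K ∧
      Skelφ.Lip G (fineO κ Φ t p D DT ori g f) ∧
      RunGeom G (Skelφ.cellGeomSG₂ G (fineO κ Φ t p D DT ori g f) (fcells κ Φ t p (D.orient DT ori) g f) t Λ) ∧
      AnchGeom (Skelφ.cellGeomSG₂ G (fineO κ Φ t p D DT ori g f) (fcells κ Φ t p (D.orient DT ori) g f) t Λ) ∧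
      SepGeom₂ G (Skelφ.cellGeomSG₂ G (fineO κ Φ t p D DT ori g f) (fcells κ Φ t p (D.orient DT ori) g f) t Λ) ∧
      ExitGeom G (Skelφ.cellGeomSG₂ G (fineO κ Φ t p D DT ori g f) (fcells κ Φ t p (D.orient DT ori) g f) t Λ) ∧
      StepsGeom (Skelφ.cellGeomSG₂ G (fineO κ Φ t p D DT ori g f) (fcells κ Φ t p (D.orient DT ori) g f) t Λ)
        (Skelφ.faceDataSG G (fineO κ Φ t p D DT ori g f) (fcells κ Φ t p (D.orient DT ori) g f) t Λ) ∧
      LevelGeom G (Skelφ.cellGeomSG₂ G (fineO κ Φ t p D DT ori g f) (fcells κ Φ t p (D.orient DT ori) g f) t Λ)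
        (Skelφ.faceDataSG G (fineO κ Φ t p D DT ori g f) (fcells κ Φ t p (D.orient DT ori) g f) t Λ)
        (Skelφ.levelDataS (fineO κ Φ t p D DT ori g f) (fcells κ Φ t p (D.orient DT ori) g f)) :=
  geom_fine_at κ Φ t p (D.orient DT ori) g f (lip_φL κ Φ t p D DT ori g f) (steps_φL κ Φ t p D DT ori g f) (eqNumL_of_factsO κ Φ t p D DT ori g f hR hfacts) hΛ hcolQ

end LOLevel

end NegB

end PlanarSkeletonFrm

end Summit.CriticalPhenomena.PercolationContinuityZ3.Theorems.Transplant

end
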